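import Summits.HodgeConjecture.HodgeConjecture.Theorems.Ring2AbelianAllAndreInvariantRationality
import Literature.AlgebraicGeometry.HodgeTheory.ClassesSupportedOnComplexification
import HarnessLib

/-!
# Ring 2 · sub-cell AbelianAll (ALL ABELIAN VARIETIES), André axis, part XVII-b — THE TRANSPORT AND LIFT NODES
# ARE LATTICE STATEMENTS ABOUT THE SUBSPACES OF ALGEBRAIC CLASSES: no rationality and no Hodge type occur in
# (1.1)_f, (2), (3), (4), (L), (L∀) once they are read on complex cohomology — (4) says
# `(j_t^*)⁻¹ N^p(𝒳_t) ⊆ (j_s^*)⁻¹ N^p(𝒳_s)` for CM points `t`, (L∀) says `(j_s^*)⁻¹ N^p(𝒳_s) = N^p(𝒳) + ker j_s^*`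

HONEST FRAMING (page 1, verbatim): **research route, not a corollary; conditional on HC_CM plus one named
minimal statement.** Cell line: research route conditional on HC_CM; not a corollary; Q11.4-sentence-2
already refuted in dim ≥ 3. Nothing in this file proves a case of the Hodge conjecture for an abelian variety.
`HC_CM` = `Theses.RankFourFaces.CMAbelianHodge` does not occur in this file; item
`Theses.RankFourFaces.CMToAbelian` (stmt-16267) OPEN and not closed here. Seat `pub-hodge-ring2-ab-andre-2`,
gen 9 (sequel of part XVII-a, owed item (o22) of RING2-MAP §AbelianAll AA2.67).

## What is proved (theorems only; no definition, no named fact, no sorry)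

§1 **Base change and preimages** (linear algebra over `ℚ ⊆ ℂ`): `mem_baseChange_comap_iff` — for a `ℚ`-linear
`φ : V' → V` and a `ℚ`-subspace `P ⊆ V`, `x ∈ (φ⁻¹ P) ⊗ ℂ ↔ (φ ⊗ ℂ) x ∈ P ⊗ ℂ` (flatness of `ℂ/ℚ`, twice the
tree's `Motives.HodgeStructure.mem_baseChange_ker_iff`).

§2 **Preimages of rationally spanned subspaces are rationally spanned**: for a morphism `g : Y ⟶ X` into a smooth
projective `X` and a `ℂ`-subspace `A ⊆ Hᵏ(Y(ℂ); ℂ)` contained in the span of its rational classes,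
`comap_complexBetti_map_le_span_isRationalClass`: every `W ∈ Hᵏ(X(ℂ); ℂ)` with `g^* W ∈ A` is a `ℂ`-combination
of RATIONAL classes `W'` with `g^* W' ∈ A` (universal coefficients `Hᵏ(–; ℚ) ⊗ ℂ = Hᵏ(–; ℂ)` on both sides,
naturality of `β = ofRatClassBaseChange`, §1 for `φ = g^*|_{Hᵏ(X; ℚ)}`). The subspaces of algebraic classes
`N^p = algebraicClasses` ARE spanned by their rational classes (the tree's `supportedClasses_le_span_isRationalClass`,
Grothendieck 1969), so on a compact pencil every global class algebraic on the fibre `𝒳_t` is a combination of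
rational global classes algebraic on `𝒳_t` (`mem_span_rational_of_map_fiberι_mem_algebraicClasses`).

§3 **THE NODES ON COMPLEX COHOMOLOGY, WITH NO RATIONALITY AND NO HODGE TYPE** (part XVII-a's rational forms +
§2 + linearity of the conclusions): `invariantCyclesHoldFor_iff_complex`, `compactAbelianPencilVHC_iff_complex`,
`cmPointedPencilVHC_iff_complex`, `cmAnchoredTransport_iff_complex`, `cmFibreAlgebraicLift_iff_complex`,
`algebraicFixedPart_iff_complex` — e.g. **(4) ⟺ "on every compact pencil of abelian varieties, a class
`W ∈ H²ᵖ(𝒳(ℂ); ℂ)` with `j_t^* W ∈ N^p(𝒳_t)` for a CM point `t` has `j_s^* W ∈ N^p(𝒳_s)` for every `s`"**.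

§4 **LATTICE FORM.** `cmAnchoredTransport_iff_comap`: (4) ⟺ `(j_t^*)⁻¹ N^p(𝒳_t) ≤ (j_s^*)⁻¹ N^p(𝒳_s)` for all
compact pencils, `p`, CM points `t` and points `s`; `invariantCyclesHoldFor_iff_comap_eq`: (1.1)_f ⟺ the subspaces
`(j_s^*)⁻¹ N^p(𝒳_s) ⊆ H²ᵖ(𝒳(ℂ); ℂ)` do not depend on `s`; `algebraicFixedPart_iff_comap_eq_sup`: (L∀) ⟺
`(j_s^*)⁻¹ N^p(𝒳_s) = N^p(𝒳) ⊔ ker j_s^*` for all compact pencils, `p`, `s` (`⊇` is the tree's restriction theorem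
`map_fiberι_mem_algebraicClasses`, so (L∀) is the inclusion `⊆`); `cmFibreAlgebraicLift_iff_comap_le_sup`: (L) ⟺
the same inclusion at CM points.

READING (RING2-MAP §AbelianAll gen 9). With part XVII-a: the `B_min` candidates of the André axis are statements
about three `ℂ`-subspaces of `H²ᵖ(𝒳(ℂ); ℂ)` per fibre — `N^p(𝒳)`, `ker j_s^*`, `(j_s^*)⁻¹ N^p(𝒳_s)` — and nothing
else; the Hodge-theoretic clauses of parts I/II and of Abdulali's (1.1) are idle on compact pencils. By part XIV-f
(`AlgebraicInvariantClassesAt hf s p` = (N_p f)(s) = "`im j_s^* ⊆ N^p(𝒳_s)` is lifted", i.e.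
`(j_s^*)⁻¹ N^p(𝒳_s) = ⊤ = N^p(𝒳) ⊔ ker j_s^*`) the node (β′_f) of parts V–XVI is the case "`im j_s^* ⊆ N^p(𝒳_s)`"
of the same identity. EDGE LABELS: all K unconditional; no def, no named fact, no Hodge-conjecture input,
`HC_CM` absent.

References: GrothendieckTopology1969 (§1 pp. 299–300); VoisinHodgeI2002 (§7.1.1, §11.3); HatcherAT2002 (§3.1
Thm. 3.2, p. 198); DeligneHodgeII1971 (Cor. 4.1.2, Thm. 4.1.1); Andre1996Motifs (§5.1 (A4) p. 25, §6.3 p. 33);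
Abdulali1994FamiliesAV ((1.1) p. 1122, Conj. 5.3 / Thm. 5.5 p. 1130); Milne2020HodgeClassesAV (Prop. 1);
Fulton1998 (§10.1 Cor. 10.1, §19.2 Cor. 19.2 (b)).
-/

noncomputable section

set_option linter.dupNamespace false

open scoped TensorProduct

namespace Summit.HodgeConjecture.HodgeConjecture.Ring2.AbelianAll

open CategoryTheory AlgebraicGeometry
open Literature.AlgebraicGeometry Literature.AlgebraicGeometry.Motives
open Literature.AlgebraicGeometry.HodgeTheory
open Literature.AlgebraicTopology.SingularHomology (singularCohomology)
open Literature.AlgebraicGeometry.Abdulali1994 (InvariantCyclesHoldFor)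
open Literature.AlgebraicGeometry.Deligne1982 (cmLocus)
open Summit.HodgeConjecture.HodgeConjecture.Ring2.Deform (CompactAbelianPencilVHC)

/-! ## §1 Base change commutes with preimages -/

section LinearAlgebra

universe u v

variable {V : Type u} [AddCommGroup V] [Module ℚ V] {V' : Type v} [AddCommGroup V'] [Module ℚ V']

/-- **`(φ⁻¹ P) ⊗ ℂ = (φ ⊗ ℂ)⁻¹ (P ⊗ ℂ)`** for a `ℚ`-linear map `φ : V' → V` and a `ℚ`-subspace `P ⊆ V` (`ℂ` is
flat over `ℚ`: `P = ker (V → V/P)`, `φ⁻¹ P = ker (V' → V → V/P)`, and base change commutes with kernels — the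
tree's `Motives.HodgeStructure.mem_baseChange_ker_iff`, twice). [folklore] -/
theorem mem_baseChange_comap_iff (φ : V' →ₗ[ℚ] V) (P : Submodule ℚ V) (x : ℂ ⊗[ℚ] V') :
    x ∈ (P.comap φ).baseChange ℂ ↔ φ.baseChange ℂ x ∈ P.baseChange ℂ := by
  have hP : P.comap φ = LinearMap.ker (P.mkQ ∘ₗ φ) := by rw [LinearMap.ker_comp, Submodule.ker_mkQ]
  rw [hP, HodgeStructure.mem_baseChange_ker_iff, LinearMap.baseChange_comp, LinearMap.comp_apply]
  conv_rhs => rw [← Submodule.ker_mkQ P]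
  rw [HodgeStructure.mem_baseChange_ker_iff]

end LinearAlgebra

/-! ## §2 Preimages of rationally spanned subspaces are rationally spanned -/

section Morphisms

variable {n : ℕ} {X Y : SchemeOver ℂ}

/-- **The preimage under `g^*` of a rationally spanned subspace is rationally spanned.** Let `g : Y ⟶ X` be a
morphism into a smooth projective `X` and `A ⊆ Hᵏ(Y(ℂ); ℂ)` a `ℂ`-subspace contained in the span of its rational
classes. Then every `W ∈ Hᵏ(X(ℂ); ℂ)` with `g^* W ∈ A` is a `ℂ`-linear combination of RATIONAL classes `W'` with
`g^* W' ∈ A`. Proof: with `β : Hᵏ(–; ℚ) ⊗ ℂ → Hᵏ(–; ℂ)` (onto for `X`, injective for `Y`; universal coefficients)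
and `A_ℚ = {a | a ⊗ 1 ∈ A}`, `β_Y⁻¹ A ⊆ A_ℚ ⊗ ℂ`; writing `W = β_X(τ)`, naturality gives
`(g^* ⊗ ℂ) τ ∈ A_ℚ ⊗ ℂ`, so `τ ∈ ((g^*)⁻¹ A_ℚ) ⊗ ℂ` (§1), a combination of vectors `1 ⊗ w` with `g^* w ∈ A_ℚ`.
[cite: VoisinHodgeI2002, §7.1.1] [cite: HatcherAT2002, §3.1 Thm. 3.2 and p. 198] -/
theorem comap_complexBetti_map_le_span_isRationalClass (hX : IsSmoothProjective n X) (g : Y ⟶ X) {k : ℕ}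
    (A : Submodule ℂ (complexBetti Y k))
    (hA : A ≤ Submodule.span ℂ {c : complexBetti Y k | IsRationalClass c ∧ c ∈ A})
    {W : complexBetti X k} (hW : complexBetti.map g k W ∈ A) :
    W ∈ Submodule.span ℂ {W' : complexBetti X k | IsRationalClass W' ∧ complexBetti.map g k W' ∈ A} := by
  set βY := ofRatClassBaseChange (ComplexPoints Y) k with hβY
  -- the `ℚ`-form of `A`
  let Aℚ : Submodule ℚ (bettiCohomology Y k) :=
    ((A.comap βY).restrictScalars ℚ).comap HodgeStructure.ofRat
  have hAℚ : ∀ a : bettiCohomology Y k, a ∈ Aℚ ↔ ofRatClass (ComplexPoints Y) k a ∈ A := fun a ↦ by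
    change βY (HodgeStructure.ofRat a) ∈ A ↔ _
    rw [hβY, ofRatClassBaseChange_ofRat]
  -- `β_Y⁻¹ A ⊆ A_ℚ ⊗ ℂ`
  have h1 : ∀ x, βY x ∈ A → x ∈ Aℚ.baseChange ℂ := by
    intro x hx
    have hle : Submodule.span ℂ {c : complexBetti Y k | IsRationalClass c ∧ c ∈ A} ≤
        (Aℚ.baseChange ℂ).map βY := by
      refine Submodule.span_le.2 ?_
      rintro c ⟨hc, hcA⟩
      obtain ⟨a, rfl⟩ := (isRationalClass_iff_mem_range_ofRatClass c).1 hc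
      refine ⟨HodgeStructure.ofRat a, ?_, by rw [hβY, ofRatClassBaseChange_ofRat]⟩
      rw [HodgeStructure.ofRat_apply]
      exact Submodule.tmul_mem_baseChange_of_mem 1 ((hAℚ a).2 hcA)
    obtain ⟨y, hy, hyx⟩ := hle (hA hx)
    rwa [← ofRatClassBaseChange_injective _ k hyx]
  -- write `W = β_X τ` and move through naturality
  obtain ⟨τ, rfl⟩ := ofRatClassBaseChange_surjective hX k W
  set φ : bettiCohomology X k →ₗ[ℚ] bettiCohomology Y k := (bettiCohomology.map g k).hom with hφ
  have hnat : ∀ t, complexBetti.map g k (ofRatClassBaseChange (ComplexPoints X) k t) = βY (φ.baseChange ℂ t) :=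
    fun t ↦ map_ofRatClassBaseChange (g := AlgPoints.mapContinuous (L := ℂ) g) (t := t)
  have hτ : τ ∈ (Aℚ.comap φ).baseChange ℂ := by
    rw [mem_baseChange_comap_iff]
    exact h1 _ (by rw [← hnat]; exact hW)
  -- the generators `1 ⊗ w`, `g^* w ∈ A_ℚ`, go to rational classes `w ⊗ 1` with `g^*(w ⊗ 1) ∈ A`
  rw [Submodule.baseChange_eq_span] at hτ
  have hmap : ofRatClassBaseChange (ComplexPoints X) k τ ∈
      (Submodule.span ℂ ((Aℚ.comap φ).map (TensorProduct.mk ℚ ℂ (bettiCohomology X k) 1) :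
        Set (ℂ ⊗[ℚ] bettiCohomology X k))).map (ofRatClassBaseChange (ComplexPoints X) k) :=
    Submodule.mem_map_of_mem hτ
  rw [Submodule.map_span] at hmap
  refine Submodule.span_mono ?_ hmap
  rintro _ ⟨_, ⟨w, hw, rfl⟩, rfl⟩
  have hw' : ofRatClass (ComplexPoints Y) k (φ w) ∈ A := (hAℚ _).1 (Submodule.mem_comap.1 hw)
  refine ⟨?_, ?_⟩
  · change IsRationalClass (ofRatClassBaseChange (ComplexPoints X) k ((1 : ℂ) ⊗ₜ[ℚ] w))
    rw [ofRatClassBaseChange_tmul, one_smul]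
    exact isRationalClass_ofRatClass w
  · change complexBetti.map g k (ofRatClassBaseChange (ComplexPoints X) k ((1 : ℂ) ⊗ₜ[ℚ] w)) ∈ A
    rw [ofRatClassBaseChange_tmul, one_smul]
    have hm : complexBetti.map g k (ofRatClass (ComplexPoints X) k w) = ofRatClass (ComplexPoints Y) k (φ w) :=
      (ofRatClass_map (f := AlgPoints.mapContinuous (L := ℂ) g) (a := w)).symm
    rw [hm]
    exact hw'

end Morphisms

variable {𝒳 S : SchemeOver ℂ}

/-- **On a compact pencil, a global class algebraic on the fibre `𝒳_t` is a `ℂ`-combination of RATIONAL global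
classes algebraic on `𝒳_t`** (§2 for `j_t : 𝒳_t ⟶ 𝒳` and `A = N^p(𝒳_t)`, which is spanned by its rational
classes: Grothendieck's `N^p ⊗ ℂ`, the tree's `supportedClasses_le_span_isRationalClass`).
[cite: GrothendieckTopology1969, §1 pp. 299–300] [cite: VoisinHodgeI2002, §7.1.1] -/
theorem mem_span_rational_of_map_fiberι_mem_algebraicClasses {d : ℕ} {f : 𝒳 ⟶ S}
    (hf : IsCompactAbelianPencil f d) {p : ℕ} {W : complexBetti 𝒳 (2 * p)} {t : ComplexPoints S}
    (hW : complexBetti.map (fiberι f t) (2 * p) W ∈ algebraicClasses (fiberOver f t) p) :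
    W ∈ Submodule.span ℂ {W' : complexBetti 𝒳 (2 * p) | IsRationalClass W' ∧
      complexBetti.map (fiberι f t) (2 * p) W' ∈ algebraicClasses (fiberOver f t) p} :=
  comap_complexBetti_map_le_span_isRationalClass hf.isSmoothProjective_total (fiberι f t)
    (algebraicClasses (fiberOver f t) p)
    (supportedClasses_le_span_isRationalClass (hf.isSmoothProjective_fiberOver t) (2 * p) p) hW

/-! ## §3 The nodes on complex cohomology: no rationality, no Hodge type -/

/-- **(1.1)_f on complex cohomology.** On a compact pencil of abelian `d`-folds, `InvariantCyclesHoldFor f d` ⟺ for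
every `p` and EVERY `W ∈ H²ᵖ(𝒳(ℂ); ℂ)`: `j_{s₀}^* W ∈ N^p(𝒳_{s₀})` for one `s₀` implies `j_s^* W ∈ N^p(𝒳_s)` for all
`s`. [cite: Abdulali1994FamiliesAV, (1.1) (p. 1122)] [cite: GrothendieckTopology1969, §1 pp. 299–300] -/
theorem invariantCyclesHoldFor_iff_complex {d : ℕ} {f : 𝒳 ⟶ S} (hf : IsCompactAbelianPencil f d) :
    InvariantCyclesHoldFor f d ↔ ∀ (p : ℕ) (W : complexBetti 𝒳 (2 * p)),
      (∃ s₀ : ComplexPoints S, complexBetti.map (fiberι f s₀) (2 * p) W ∈ algebraicClasses (fiberOver f s₀) p) →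
      ∀ s : ComplexPoints S, complexBetti.map (fiberι f s) (2 * p) W ∈ algebraicClasses (fiberOver f s) p := by
  rw [invariantCyclesHoldFor_iff_rational hf]
  refine ⟨fun h p W hs₀ s ↦ ?_, fun h p W _ hs₀ ↦ h p W hs₀⟩
  obtain ⟨s₀, h₀⟩ := hs₀
  refine (Submodule.span_le (p := (algebraicClasses (fiberOver f s) p).comap
      (complexBetti.map (fiberι f s) (2 * p)).hom)).2 ?_
    (mem_span_rational_of_map_fiberι_mem_algebraicClasses hf h₀)
  rintro W' ⟨hW', hW't⟩
  exact h p W' hW' ⟨s₀, hW't⟩ s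

/-- **(2) on complex cohomology**: `Deform.CompactAbelianPencilVHC` ⟺ on every compact pencil of abelian varieties,
`j_{s₀}^* W ∈ N^p(𝒳_{s₀})` for one fibre implies `j_s^* W ∈ N^p(𝒳_s)` for all, for every complex class `W` of the
total space. [cite: Andre1996Motifs, §6.3 Remarque 2 (p. 33)] [cite: Abdulali1994FamiliesAV, (1.1) (p. 1122)] -/
theorem compactAbelianPencilVHC_iff_complex :
    CompactAbelianPencilVHC ↔ ∀ ⦃d : ℕ⦄ ⦃𝒳 S : SchemeOver ℂ⦄ (f : 𝒳 ⟶ S), IsCompactAbelianPencil f d →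
      ∀ (p : ℕ) (W : complexBetti 𝒳 (2 * p)),
        (∃ s₀ : ComplexPoints S, complexBetti.map (fiberι f s₀) (2 * p) W ∈ algebraicClasses (fiberOver f s₀) p) →
        ∀ s : ComplexPoints S, complexBetti.map (fiberι f s) (2 * p) W ∈ algebraicClasses (fiberOver f s) p :=
  ⟨fun h _ _ _ f hf ↦ (invariantCyclesHoldFor_iff_complex hf).1 (h f hf),
    fun h _ _ _ f hf ↦ (invariantCyclesHoldFor_iff_complex hf).2 (h f hf)⟩

/-- **(3) on complex cohomology.** [cite: Andre1996Motifs, Lemme 6.3.1 (p. 31) and Remarque 2 (p. 33)] -/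
theorem cmPointedPencilVHC_iff_complex :
    CMPointedPencilVHC ↔ ∀ ⦃d : ℕ⦄ ⦃𝒳 S : SchemeOver ℂ⦄ (f : 𝒳 ⟶ S), IsCompactAbelianPencil f d →
      (cmLocus f d).Nonempty → ∀ (p : ℕ) (W : complexBetti 𝒳 (2 * p)),
        (∃ s₀ : ComplexPoints S, complexBetti.map (fiberι f s₀) (2 * p) W ∈ algebraicClasses (fiberOver f s₀) p) →
        ∀ s : ComplexPoints S, complexBetti.map (fiberι f s) (2 * p) W ∈ algebraicClasses (fiberOver f s) p :=
  ⟨fun h _ _ _ f hf hne ↦ (invariantCyclesHoldFor_iff_complex hf).1 (h f hf hne),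
    fun h _ _ _ f hf hne ↦ (invariantCyclesHoldFor_iff_complex hf).2 (h f hf hne)⟩

/-- **(4) on complex cohomology: `CMAnchoredTransport` ⟺ "on every compact pencil of abelian varieties, every
`W ∈ H²ᵖ(𝒳(ℂ); ℂ)` with `j_t^* W ∈ N^p(𝒳_t)` for a CM point `t` has `j_s^* W ∈ N^p(𝒳_s)` for every `s`".**
[cite: Andre1996Motifs, §6.3 a) (p. 33)] [cite: Abdulali1994FamiliesAV, Lemma 6.2 (p. 1131)] [cite: GrothendieckTopology1969, §1 pp. 299–300] -/
theorem cmAnchoredTransport_iff_complex :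
    CMAnchoredTransport ↔ ∀ ⦃d : ℕ⦄ ⦃𝒳 S : SchemeOver ℂ⦄ (f : 𝒳 ⟶ S), IsCompactAbelianPencil f d →
      ∀ (p : ℕ) (W : complexBetti 𝒳 (2 * p)), ∀ t ∈ cmLocus f d,
        complexBetti.map (fiberι f t) (2 * p) W ∈ algebraicClasses (fiberOver f t) p →
        ∀ s : ComplexPoints S, complexBetti.map (fiberι f s) (2 * p) W ∈ algebraicClasses (fiberOver f s) p := by
  rw [cmAnchoredTransport_iff_rational]
  refine ⟨fun h d 𝒳 S f hf p W t ht h₀ s ↦ ?_, fun h d 𝒳 S f hf p W _ t ht h₀ ↦ h f hf p W t ht h₀⟩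
  refine (Submodule.span_le (p := (algebraicClasses (fiberOver f s) p).comap
      (complexBetti.map (fiberι f s) (2 * p)).hom)).2 ?_
    (mem_span_rational_of_map_fiberι_mem_algebraicClasses hf h₀)
  rintro W' ⟨hW', hW't⟩
  exact h f hf p W' hW' t ht hW't s

/-- **(L) on complex cohomology: `CMFibreAlgebraicLift` ⟺ "on every compact pencil of abelian varieties, every
`W ∈ H²ᵖ(𝒳(ℂ); ℂ)` with `j_t^* W ∈ N^p(𝒳_t)` for a CM point `t` agrees on `𝒳_t` with some `η ∈ N^p(𝒳)`".**
[cite: Andre1996Motifs, §5.1 (p. 25)] [cite: Milne2020HodgeClassesAV, Prop. 1, last line of the proof (p. 8)] -/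
theorem cmFibreAlgebraicLift_iff_complex :
    CMFibreAlgebraicLift ↔ ∀ ⦃d : ℕ⦄ ⦃𝒳 S : SchemeOver ℂ⦄ (f : 𝒳 ⟶ S), IsCompactAbelianPencil f d →
      ∀ (p : ℕ) (W : complexBetti 𝒳 (2 * p)), ∀ t ∈ cmLocus f d,
        complexBetti.map (fiberι f t) (2 * p) W ∈ algebraicClasses (fiberOver f t) p →
        ∃ η ∈ algebraicClasses 𝒳 p,
          complexBetti.map (fiberι f t) (2 * p) η = complexBetti.map (fiberι f t) (2 * p) W := by
  rw [cmFibreAlgebraicLift_iff_rational]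
  refine ⟨fun h d 𝒳 S f hf p W t ht h₀ ↦ ?_, fun h d 𝒳 S f hf p W _ t ht h₀ ↦ h f hf p W t ht h₀⟩
  -- the classes agreeing on `𝒳_t` with an algebraic class of `𝒳` form the submodule `(j_t^*)⁻¹(j_t^* N^p(𝒳))`
  have hle : Submodule.span ℂ {W' : complexBetti 𝒳 (2 * p) | IsRationalClass W' ∧
      complexBetti.map (fiberι f t) (2 * p) W' ∈ algebraicClasses (fiberOver f t) p} ≤
      ((algebraicClasses 𝒳 p).map (complexBetti.map (fiberι f t) (2 * p)).hom).comap
        (complexBetti.map (fiberι f t) (2 * p)).hom := by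
    refine Submodule.span_le.2 ?_
    rintro W' ⟨hW', hW't⟩
    obtain ⟨η, hη, hηt⟩ := h f hf p W' hW' t ht hW't
    exact ⟨η, hη, hηt⟩
  obtain ⟨η, hη, hηt⟩ := hle (mem_span_rational_of_map_fiberι_mem_algebraicClasses hf h₀)
  exact ⟨η, hη, hηt⟩

/-- **(L∀) on complex cohomology: `AlgebraicFixedPart` ⟺ "on every compact pencil of abelian varieties, every
`W ∈ H²ᵖ(𝒳(ℂ); ℂ)` with `j_s^* W ∈ N^p(𝒳_s)` agrees on `𝒳_s` with some `η ∈ N^p(𝒳)`", every `s`.**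
[cite: Milne2020HodgeClassesAV, Prop. 1 (p. 7)] [cite: Andre1996Motifs, Remarque 2 (p. 33)] -/
theorem algebraicFixedPart_iff_complex :
    AlgebraicFixedPart ↔ ∀ ⦃d : ℕ⦄ ⦃𝒳 S : SchemeOver ℂ⦄ (f : 𝒳 ⟶ S), IsCompactAbelianPencil f d →
      ∀ (p : ℕ) (W : complexBetti 𝒳 (2 * p)) (s₀ : ComplexPoints S),
        complexBetti.map (fiberι f s₀) (2 * p) W ∈ algebraicClasses (fiberOver f s₀) p →
        ∃ η ∈ algebraicClasses 𝒳 p,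
          complexBetti.map (fiberι f s₀) (2 * p) η = complexBetti.map (fiberι f s₀) (2 * p) W := by
  rw [algebraicFixedPart_iff_rational]
  refine ⟨fun h d 𝒳 S f hf p W s₀ h₀ ↦ ?_, fun h d 𝒳 S f hf p W _ s₀ h₀ ↦ h f hf p W s₀ h₀⟩
  have hle : Submodule.span ℂ {W' : complexBetti 𝒳 (2 * p) | IsRationalClass W' ∧
      complexBetti.map (fiberι f s₀) (2 * p) W' ∈ algebraicClasses (fiberOver f s₀) p} ≤
      ((algebraicClasses 𝒳 p).map (complexBetti.map (fiberι f s₀) (2 * p)).hom).comap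
        (complexBetti.map (fiberι f s₀) (2 * p)).hom := by
    refine Submodule.span_le.2 ?_
    rintro W' ⟨hW', hW't⟩
    obtain ⟨η, hη, hηt⟩ := h f hf p W' hW' s₀ hW't
    exact ⟨η, hη, hηt⟩
  obtain ⟨η, hη, hηt⟩ := hle (mem_span_rational_of_map_fiberι_mem_algebraicClasses hf h₀)
  exact ⟨η, hη, hηt⟩

/-! ## §4 Lattice form: the nodes as relations between `N^p(𝒳)`, `ker j_s^*` and `(j_s^*)⁻¹ N^p(𝒳_s)` -/

/-- **(4) in lattice form**: `CMAnchoredTransport` ⟺ for every compact pencil of abelian varieties, every `p`, every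
CM point `t` and every point `s`, `(j_t^*)⁻¹ N^p(𝒳_t) ≤ (j_s^*)⁻¹ N^p(𝒳_s)` in `H²ᵖ(𝒳(ℂ); ℂ)`.
[cite: Andre1996Motifs, §6.3 a) (p. 33)] [cite: Abdulali1994FamiliesAV, Lemma 6.2 (p. 1131)] -/
theorem cmAnchoredTransport_iff_comap :
    CMAnchoredTransport ↔ ∀ ⦃d : ℕ⦄ ⦃𝒳 S : SchemeOver ℂ⦄ (f : 𝒳 ⟶ S), IsCompactAbelianPencil f d →
      ∀ (p : ℕ), ∀ t ∈ cmLocus f d, ∀ s : ComplexPoints S,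
        (algebraicClasses (fiberOver f t) p).comap (complexBetti.map (fiberι f t) (2 * p)).hom ≤
          (algebraicClasses (fiberOver f s) p).comap (complexBetti.map (fiberι f s) (2 * p)).hom := by
  rw [cmAnchoredTransport_iff_complex]
  exact ⟨fun h d 𝒳 S f hf p t ht s W hW ↦ h f hf p W t ht hW s,
    fun h d 𝒳 S f hf p W t ht h₀ s ↦ h f hf p t ht s h₀⟩

/-- **(1.1)_f in lattice form**: on a compact pencil, `InvariantCyclesHoldFor f d` ⟺ the subspace
`(j_s^*)⁻¹ N^p(𝒳_s) ⊆ H²ᵖ(𝒳(ℂ); ℂ)` of global classes algebraic on `𝒳_s` does not depend on `s`.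
[cite: Abdulali1994FamiliesAV, (1.1) (p. 1122)] [cite: CharlesSchnell2014Notes, (11.3.1)] -/
theorem invariantCyclesHoldFor_iff_comap_eq {d : ℕ} {f : 𝒳 ⟶ S} (hf : IsCompactAbelianPencil f d) :
    InvariantCyclesHoldFor f d ↔ ∀ (p : ℕ) (s s' : ComplexPoints S),
      (algebraicClasses (fiberOver f s) p).comap (complexBetti.map (fiberι f s) (2 * p)).hom =
        (algebraicClasses (fiberOver f s') p).comap (complexBetti.map (fiberι f s') (2 * p)).hom := by
  rw [invariantCyclesHoldFor_iff_complex hf]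
  refine ⟨fun h p s s' ↦ le_antisymm (fun W hW ↦ h p W ⟨s, hW⟩ s') (fun W hW ↦ h p W ⟨s', hW⟩ s),
    fun h p W hs₀ s ↦ ?_⟩
  obtain ⟨s₀, h₀⟩ := hs₀
  have hmem : W ∈ (algebraicClasses (fiberOver f s₀) p).comap (complexBetti.map (fiberι f s₀) (2 * p)).hom := h₀
  rw [h p s₀ s] at hmem
  exact hmem

/-- **`N^p(𝒳) ⊔ ker j_s^* ≤ (j_s^*)⁻¹ N^p(𝒳_s)` always**: algebraic classes of the total space restrict to
algebraic classes of the fibre (the tree's `map_fiberι_mem_algebraicClasses`, Fulton Cor. 10.1 / 19.2 (b)).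
[cite: Fulton1998, §10.1 Cor. 10.1 and §19.2 Cor. 19.2 (b)] -/
theorem algebraicClasses_sup_ker_le_comap {d : ℕ} {f : 𝒳 ⟶ S} (hf : IsCompactAbelianPencil f d) (p : ℕ)
    (s : ComplexPoints S) :
    algebraicClasses 𝒳 p ⊔ LinearMap.ker (complexBetti.map (fiberι f s) (2 * p)).hom ≤
      (algebraicClasses (fiberOver f s) p).comap (complexBetti.map (fiberι f s) (2 * p)).hom := by
  have hSqp : IsQuasiProjectiveOver S :=
    IsQuasiProjectiveOver.of_isProjectiveOver hf.isSmoothProjective_base.isProjectiveOver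
  have hS : AlgebraicGeometry.Smooth S.hom := Andre1996.compactPencil_smooth_base hf
  haveI : IrreducibleSpace S.left := Andre1996.compactPencil_irreducibleSpace_base hf
  haveI := hS
  refine sup_le (fun η hη ↦ ?_) (fun κ hκ ↦ ?_)
  · exact map_fiberι_mem_algebraicClasses f hf.isSmoothProjectiveFamily hSqp hη s
  · rw [LinearMap.mem_ker] at hκ
    change (complexBetti.map (fiberι f s) (2 * p)).hom κ ∈ algebraicClasses (fiberOver f s) p
    rw [hκ]
    exact Submodule.zero_mem _

/-- **(L∀) in lattice form: `AlgebraicFixedPart` ⟺ `(j_s^*)⁻¹ N^p(𝒳_s) = N^p(𝒳) ⊔ ker j_s^*`** for every compact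
pencil of abelian varieties, every `p` and every point `s` (the algebraic théorème de la partie fixe as a lattice
identity in `H²ᵖ(𝒳(ℂ); ℂ)`; `⊇` is unconditional, `algebraicClasses_sup_ker_le_comap`).
[cite: Milne2020HodgeClassesAV, Prop. 1 (p. 7)] [cite: Andre1996Motifs, Remarque 2 (p. 33)] -/
theorem algebraicFixedPart_iff_comap_eq_sup :
    AlgebraicFixedPart ↔ ∀ ⦃d : ℕ⦄ ⦃𝒳 S : SchemeOver ℂ⦄ (f : 𝒳 ⟶ S), IsCompactAbelianPencil f d →
      ∀ (p : ℕ) (s : ComplexPoints S),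
        (algebraicClasses (fiberOver f s) p).comap (complexBetti.map (fiberι f s) (2 * p)).hom =
          algebraicClasses 𝒳 p ⊔ LinearMap.ker (complexBetti.map (fiberι f s) (2 * p)).hom := by
  rw [algebraicFixedPart_iff_complex]
  refine ⟨fun h d 𝒳 S f hf p s ↦ le_antisymm (fun W hW ↦ ?_) (algebraicClasses_sup_ker_le_comap hf p s),
    fun h d 𝒳 S f hf p W s h₀ ↦ ?_⟩
  · obtain ⟨η, hη, hηs⟩ := h f hf p W s hW
    rw [show W = η + (W - η) by abel]
    refine Submodule.add_mem_sup hη ?_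
    rw [LinearMap.mem_ker, map_sub, sub_eq_zero]
    exact hηs.symm
  · have hmem : W ∈ (algebraicClasses (fiberOver f s) p).comap (complexBetti.map (fiberι f s) (2 * p)).hom := h₀
    rw [h f hf p s] at hmem
    obtain ⟨η, hη, κ, hκ, hW⟩ := Submodule.mem_sup.1 hmem
    refine ⟨η, hη, ?_⟩
    rw [LinearMap.mem_ker] at hκ
    rw [← hW, map_add]
    change _ = _ + (complexBetti.map (fiberι f s) (2 * p)).hom κ
    rw [hκ, add_zero]

/-- **(L) in lattice form: `CMFibreAlgebraicLift` ⟺ `(j_t^*)⁻¹ N^p(𝒳_t) ≤ N^p(𝒳) ⊔ ker j_t^*` at every CM point `t`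
of every compact pencil of abelian varieties.** [cite: Andre1996Motifs, §5.1 (p. 25) and §6.3 (p. 33)]
[cite: Milne2020HodgeClassesAV, Prop. 1 (p. 8)] -/
theorem cmFibreAlgebraicLift_iff_comap_le_sup :
    CMFibreAlgebraicLift ↔ ∀ ⦃d : ℕ⦄ ⦃𝒳 S : SchemeOver ℂ⦄ (f : 𝒳 ⟶ S), IsCompactAbelianPencil f d →
      ∀ (p : ℕ), ∀ t ∈ cmLocus f d,
        (algebraicClasses (fiberOver f t) p).comap (complexBetti.map (fiberι f t) (2 * p)).hom ≤
          algebraicClasses 𝒳 p ⊔ LinearMap.ker (complexBetti.map (fiberι f t) (2 * p)).hom := by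
  rw [cmFibreAlgebraicLift_iff_complex]
  refine ⟨fun h d 𝒳 S f hf p t ht W hW ↦ ?_, fun h d 𝒳 S f hf p W t ht h₀ ↦ ?_⟩
  · obtain ⟨η, hη, hηs⟩ := h f hf p W t ht hW
    rw [show W = η + (W - η) by abel]
    refine Submodule.add_mem_sup hη ?_
    rw [LinearMap.mem_ker, map_sub, sub_eq_zero]
    exact hηs.symm
  · obtain ⟨η, hη, κ, hκ, hW⟩ := Submodule.mem_sup.1 (h f hf p t ht h₀)
    refine ⟨η, hη, ?_⟩
    rw [LinearMap.mem_ker] at hκ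
    rw [← hW, map_add]
    change _ = _ + (complexBetti.map (fiberι f t) (2 * p)).hom κ
    rw [hκ, add_zero]

/-- **(1.1)_f ⟸ (L∀)|_f in lattice form, and the place of (N_p f)(s)**: part XIV-f's `AlgebraicInvariantClassesAt hf s p`
says `(j_s^*)⁻¹ N^p(𝒳_s) = ⊤ = N^p(𝒳) ⊔ ker j_s^*` — every global class is algebraic on `𝒳_s` up to `ker j_s^*`.
[cite: Abdulali1994FamiliesAV, Conjecture 5.3 and Theorem 5.5 (p. 1130)] -/
theorem algebraicInvariantClassesAt_iff_sup_eq_top {d : ℕ} {f : 𝒳 ⟶ S} (hf : IsCompactAbelianPencil f d)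
    (s : ComplexPoints S) (p : ℕ) :
    AlgebraicInvariantClassesAt hf s p ↔
      algebraicClasses 𝒳 p ⊔ LinearMap.ker (complexBetti.map (fiberι f s) (2 * p)).hom = ⊤ := by
  refine ⟨fun h ↦ Submodule.eq_top_iff'.2 fun W ↦ ?_, fun h W ↦ ?_⟩
  · obtain ⟨η, hη, hηs⟩ := h W
    rw [show W = η + (W - η) by abel]
    refine Submodule.add_mem_sup hη ?_
    rw [LinearMap.mem_ker, map_sub, sub_eq_zero]
    exact hηs.symm
  · obtain ⟨η, hη, κ, hκ, hW⟩ := Submodule.mem_sup.1 (show W ∈ _ ⊔ _ by rw [h]; exact Submodule.mem_top)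
    refine ⟨η, hη, ?_⟩
    rw [LinearMap.mem_ker] at hκ
    rw [← hW, map_add]
    change _ = _ + (complexBetti.map (fiberι f s) (2 * p)).hom κ
    rw [hκ, add_zero]

end Summit.HodgeConjecture.HodgeConjecture.Ring2.AbelianAll

end
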